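import Literature.AlgebraicGeometry.KTheory.CoherentGrothendieckGroupRank
import Literature.AlgebraicGeometry.Modules.ExtensionContraction
import HarnessLib

/-!
# `rank [𝒪_X] = 1` and surjectivity of the generic rank `K(X) → ℤ` (Hartshorne II Ex. 6.10 (b), second half)

Layer `Literature/AlgebraicGeometry/KTheory` (0 definitions, 0 named facts, no instances, no notation). Sequel to
`KTheory/CoherentGrothendieckGroupRank` (`KZeroCoh.genericRank : K(X) →+ ℤ`, `[F] ↦ dim_{K(X)} F_η`, on an integral
scheme), proving the normalisation listed there as "not here": **the module stalk `(𝒪_X)_η` of the structure sheaf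
(for the tree's `Modules/SkyscraperModule.stalkFunctor`) is one-dimensional over the function field
`K(X) = 𝒪_{X,η}`** — every element is `c • germ 1` (germs are compatible with the module structures,
`Modules/StalkExactCoherent.stalkGerm_smul`, and restriction maps preserve `1`, Mathlib `PresheafOfModules.unit_map_one`),
and `germ 1 ≠ 0` (its vanishing would give `1 = 0` in `Γ(X, V)` for a non-empty open `V` of the integral scheme `X`,
Mathlib `TopCat.Presheaf.germ_eq` and `IsIntegral.component_integral`); no colimit-comparison isomorphism between the
module stalk and the ring stalk is constructed. Hence (Hartshorne II Ex. 6.10 (b): "the rank function defines a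
surjective homomorphism `rank : K(X) → ℤ`"):

* `finrank_genericStalk_unitModule : dim_{K(X)} (𝒪_X)_η = 1`;
* **`KZeroCoh.genericRank_of_unitModule : rank [𝒪_X] = 1`**, `genericRank_toKZeroCoh_of_unitModule` (`rank (ε[𝒪_X]) = 1`);
* **`KZeroCoh.genericRank_surjective`**.

## References

* R. Hartshorne, *Algebraic Geometry*, GTM 52 (1977), II Ex. 6.10 (b) (p. 148). [Hartshorne1977]
* U. Görtz, T. Wedhorn, *Algebraic Geometry I*, 2nd ed. (2020), (7.8.6) (stalks of `𝒪_X`-modules). [GortzWedhorn2020]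
-/

noncomputable section

-- `TopCat.Presheaf`/`Scheme.Modules` are not reducible (as in Mathlib's `AlgebraicGeometry/Modules`).
set_option backward.isDefEq.respectTransparency false

universe u

open CategoryTheory CategoryTheory.Limits AlgebraicGeometry TopologicalSpace Opposite
open Literature.AlgebraicGeometry.Motives Literature.AlgebraicGeometry.Morphisms
  Literature.AlgebraicGeometry.Modules

namespace Literature.AlgebraicGeometry.KTheory

variable {X : Scheme.{u}}

/-- The structure sheaf is coherent in the tree's affine-local sense. [cite: Hartshorne1977, II Prop. 5.4 (p. 113)] -/
theorem coh_unitModule : Coh (unitModule X) :=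
  ⟨IsAffineLocalizing.unit, IsAffineFiniteType.unit⟩

/-- Restriction maps of `𝒪_X` (as a module over itself) preserve `1`. [cite: GortzWedhorn2020, (7.8.6)] -/
theorem unitModule_map_one {U V : X.Opens} (i : V ⟶ U) :
    (unitModule X).presheaf.map i.op ((1 : Γ(X, U)) : Γ(unitModule X, U)) = ((1 : Γ(X, V)) : Γ(unitModule X, V)) :=
  PresheafOfModules.unit_map_one (R := X.ringCatSheaf.obj) i.op

/-- A section `s` of `𝒪_X`, viewed in the module `𝒪_X`, is `s • 1`. [cite: GortzWedhorn2020, (7.8.6)] -/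
theorem unitModule_section_eq_smul_one {U : X.Opens} (s : Γ(unitModule X, U)) :
    s = (show Γ(X, U) from s) • ((1 : Γ(X, U)) : Γ(unitModule X, U)) := by
  change (show Γ(X, U) from s) = (show Γ(X, U) from s) * 1
  rw [mul_one]

variable (x : X)

/-- **Every element of the module stalk `(𝒪_X)_x` is a multiple of `germ 1`**: a germ `germ_V s` is
`(germ_V s) • germ_V 1 = (germ_V s) • germ_U 1`. [cite: GortzWedhorn2020, (7.8.6)] -/
theorem exists_smul_stalkGerm_one_eq {U : X.Opens} (hx : x ∈ U) (v : (stalkFunctor x).obj (unitModule X)) :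
    ∃ c : X.presheaf.stalk x, c • stalkGerm x (unitModule X) U hx ((1 : Γ(X, U)) : Γ(unitModule X, U)) = v := by
  obtain ⟨V, hxV, s, rfl⟩ := exists_stalkGerm_eq x (unitModule X) v
  refine ⟨X.presheaf.germ V x hxV (show Γ(X, V) from s), ?_⟩
  -- `germ_U 1 = germ_{U ⊓ V} 1 = germ_V 1`
  have hxUV : x ∈ U ⊓ V := Opens.mem_inf.mpr ⟨hx, hxV⟩
  have h₁ : stalkGerm x (unitModule X) U hx ((1 : Γ(X, U)) : Γ(unitModule X, U)) =
      stalkGerm x (unitModule X) V hxV ((1 : Γ(X, V)) : Γ(unitModule X, V)) := by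
    have e₁ := TopCat.Presheaf.germ_res_apply (unitModule X).presheaf (homOfLE (inf_le_left : U ⊓ V ≤ U)) x hxUV
      ((1 : Γ(X, U)) : Γ(unitModule X, U))
    have e₂ := TopCat.Presheaf.germ_res_apply (unitModule X).presheaf (homOfLE (inf_le_right : U ⊓ V ≤ V)) x hxUV
      ((1 : Γ(X, V)) : Γ(unitModule X, V))
    rw [unitModule_map_one] at e₁ e₂
    exact e₁.symm.trans e₂
  rw [h₁, ← stalkGerm_smul, ← unitModule_section_eq_smul_one]

/-- **`germ 1 ≠ 0` in the module stalk `(𝒪_X)_x` of an integral scheme**: otherwise `1 = 0` in `Γ(X, W)` for some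
non-empty open `W ∋ x`, contradicting `IsDomain Γ(X, W)`. [cite: Hartshorne1977, II Ex. 6.10 (b) (p. 148)] -/
theorem stalkGerm_one_ne_zero [IsIntegral X] {U : X.Opens} (hx : x ∈ U) :
    stalkGerm x (unitModule X) U hx ((1 : Γ(X, U)) : Γ(unitModule X, U)) ≠ 0 := by
  intro h
  have h0 : (unitModule X).presheaf.germ U x hx ((1 : Γ(X, U)) : Γ(unitModule X, U)) =
      (unitModule X).presheaf.germ U x hx 0 := by
    rw [map_zero]; exact h
  obtain ⟨W, hxW, iU, iV, hW⟩ := TopCat.Presheaf.germ_eq (unitModule X).presheaf x hx hx _ _ h0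
  rw [map_zero, unitModule_map_one] at hW
  haveI : Nonempty W := ⟨⟨x, hxW⟩⟩
  haveI : IsDomain Γ(X, W) := IsIntegral.component_integral W
  exact one_ne_zero (show (1 : Γ(X, W)) = 0 from hW)

/-- **`dim_{K(X)} (𝒪_X)_η = 1`**: the module stalk of the structure sheaf at the generic point of an integral scheme is
one-dimensional over the function field. [cite: Hartshorne1977, II Ex. 6.10 (b) (p. 148)] -/
theorem finrank_genericStalk_unitModule [IsIntegral X] :
    Module.finrank X.functionField ((stalkFunctor (genericPoint X)).obj (unitModule X)) = 1 :=
  (finrank_eq_one_iff_of_nonzero' _ (stalkGerm_one_ne_zero (genericPoint X) (U := ⊤) (Opens.mem_top _))).mpr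
    (exists_smul_stalkGerm_one_eq (genericPoint X) (U := ⊤) (Opens.mem_top _))

namespace KZeroCoh

variable [IsIntegral X]

/-- **`rank [𝒪_X] = 1`** (Hartshorne II Ex. 6.10 (b)). [cite: Hartshorne1977, II Ex. 6.10 (b) (p. 148)] -/
theorem genericRank_of_unitModule : genericRank (KZeroCoh.of (unitModule X) coh_unitModule) = 1 := by
  rw [genericRank_of, finrank_genericStalk_unitModule, Nat.cast_one]

/-- `rank (ε[𝒪_X]) = 1` for the class of the trivial line bundle in `K₀(X)`. [cite: Hartshorne1977, II Ex. 6.10 (b) (p. 148)] -/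
theorem genericRank_toKZeroCoh_of_unitModule :
    genericRank (KZero.toKZeroCoh (KZero.of (unitModule X) isFiniteLocallyFree_unitModule)) = 1 := by
  rw [KZero.toKZeroCoh_of _ _ coh_unitModule, genericRank_of_unitModule]

/-- **The generic rank `K(X) → ℤ` is surjective** ("the rank function defines a surjective homomorphism
`rank : K(X) → ℤ`"). [cite: Hartshorne1977, II Ex. 6.10 (b) (p. 148)] -/
theorem genericRank_surjective : Function.Surjective (genericRank (X := X)) := fun n =>
  ⟨n • KZeroCoh.of (unitModule X) coh_unitModule, by rw [map_zsmul, genericRank_of_unitModule, smul_eq_mul, mul_one]⟩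

end KZeroCoh

end Literature.AlgebraicGeometry.KTheory

end
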